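import Summits.ABC.ABC.Theses.FermatTwistHeights
import Summits.ABC.ABC.Theorems.IUTThetaPilotABCExpThreeDegOne
import HarnessLib

/-!
# `FermatTwistHeights.PolynomialABC` (stmt-ABC-1724, the polynomial-abc progress marker) from [IUTchIII] Cor. 3.12
# at the Θ-data of the RATIONAL points of the `λ`-line (route `IUTThetaPilot`, reading (U), degree-one cut)

Mochizuki, *Inter-universal Teichmüller theory IV*, Cor. 2.2–2.3 pp. 41–55 [cite: Mochizuki2012, IUTchIV Cor. 2.2–2.3 pp. 41–55].
PROOF-ONLY cross-route link (cell abc-iut, seat abc-iut-S6). `PolynomialABC := ∃ A C, ∀ abc triples, c ≤ C·rad(abc)^A`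
(route `FermatTwistHeights`, "a progress/kill marker … shared with every route that must first cross the Baker
barrier"). By `ThetaPartIIDegOne.abc_exp_three_of_cor312_degOne` (the `K_V`-free «d = 1 cut»: exponent `3 + ε`),
the registered stub `stub_cor312` of crux `ThetaPartII` RESTRICTED TO DEGREE-1 POINTS implies it with `A = 4`.
CONDITIONAL (`proof.conditional`) on the disputed input; nothing asserted; no side taken on [IUTchIII] Cor. 3.12.
-/

set_option linter.dupNamespace false

noncomputable section

namespace Summit.ABC.ABC.Theorems.ThetaPartIIDegOne

open Literature.IUT.LogVolume Literature.NumberTheory.DiophantineGeometry Literature.NumberTheory.DiophantineGeometry.GenEll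

/-- **`PolynomialABC` from [IUTchIII] Cor. 3.12 (reading (U)) at the genuine Θ-data of the degree-1 points of the
`λ`-line** (`stub_cor312` restricted to `P.degree ≤ 1`, claim form, DISPUTED — the only hypothesis): with
`A = 4`, `C` from `abc_exp_three_of_cor312_degOne` at `ε = 1`. CONDITIONAL; nothing asserted; no side taken.
[cite: Mochizuki2012, IUTchIV Cor. 2.2–2.3 pp. 41–55] [claim: Mochizuki2012, status: disputed] -/
theorem polynomialABC_of_cor312_degOne
    (h312 : ∀ P : NFPoint, P ∈ UP → P.degree ≤ 1 → ∀ l : ℕ, l.Prime → 5 ≤ l →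
      Cor22.AdmitsCore P → Cor22.CondP2 P l → Cor22.CondP5 P l → Cor22.CondP6 P l →
        Cor22.Cor312AtDatum P l) :
    Summit.ABC.ABC.Theses.FermatTwistHeights.PolynomialABC := by
  obtain ⟨C, -, hC⟩ := abc_exp_three_of_cor312_degOne h312 one_pos
  refine ⟨4, C, fun a b c ht => ?_⟩
  have h := hC a b c ht
  have e : (3 : ℝ) + 1 = 4 := by norm_num
  rw [e] at h
  have e2 : ((rad a b c : ℕ) : ℝ) ^ (4 : ℝ) = ((rad a b c : ℕ) : ℝ) ^ (4 : ℕ) := by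
    rw [← Real.rpow_natCast]; norm_num
  rw [e2] at h
  exact_mod_cast h.le

end Summit.ABC.ABC.Theorems.ThetaPartIIDegOne

end
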